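import Mathlib
import Literature.Analysis.PDE.Wave1DNearChannelLemmas
import Literature.Analysis.PDE.Wave1DFarComparison
import HarnessLib

/-!
# Near-edge channel of energy: source smallness for a polynomially small potential

Analysis/PDE support file (everything proved). The companion of
`Wave1DNearChannelLemmas.wave1D_sqrt_source_sq_le` / `wave1D_integral_sqrt_source_sq_le` when the
potential is small on the left of the receding edge in the polynomial scale
`sup_{x ≤ a−τ} V ≤ ε (1+τ)^{−5/2}` (`τ ≥ 0`) instead of the exponential one: for a global `C²`
solution `φ` of `φ_tt − φ_xx + Vφ = 0` with finite `V`-energy `EV` on `(−∞, a]`,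

  `√(∫_{b+τ}^{a−τ} (Vφ(τ,·))²) ≤ √ε (1+τ)^{−5/4} √EV`,   `∫_0^t √(…) dτ ≤ 4√ε √EV`

(`wave1D_sqrt_source_sq_le_rpow`, `wave1D_integral_sqrt_source_sq_le_rpow`; energy monotonicity on
truncated trapezoids and `∫_0^∞ (1+τ)^{−5/4} = 4`). This is hypothesis `hsrc` of
`Wave1DNearChannelForwardMajorant.wave1D_near_liminf_ge_of_source` with `σ = 4√ε`, for the reflected
far side of the `ℓ = 0` Regge–Wheeler mode (route PhotonSphereChannels, `FixedModeChannels`,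
stmt-FinalStateConjecture-10048). Folklore.
-/

noncomputable section

namespace Literature.Analysis.PDE

open MeasureTheory Set Filter Topology intervalIntegral Literature.Analysis.Calculus

variable {V : ℝ → ℝ} {φ : ℝ → ℝ → ℝ}

/-- **Pointwise source smallness, polynomial scale.** See the module docstring. [folklore] -/
theorem wave1D_sqrt_source_sq_le_rpow (hV : Continuous V) (hV0 : ∀ x, 0 ≤ V x) {a ε : ℝ}
    (hε : 0 ≤ ε) (hVε : ∀ τ : ℝ, 0 ≤ τ → ∀ x, x ≤ a - τ → V x ≤ ε * (1 + τ) ^ (-(5 : ℝ) / 2))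
    (hφ : ContDiff ℝ 2 (Function.uncurry φ))
    (hφsol : ∀ t x, iteratedDeriv 2 (fun τ => φ τ x) t - iteratedDeriv 2 (φ t) x + V x * φ t x = 0)
    (hEi : IntegrableOn (fun x => deriv (fun τ => φ τ x) 0 ^ 2 + deriv (φ 0) x ^ 2
      + V x * φ 0 x ^ 2) (Iic a))
    {τ b : ℝ} (hτ : 0 ≤ τ) (hτab : b + τ ≤ a - τ) :
    Real.sqrt (∫ x in (b + τ)..(a - τ), (-(V x * φ τ x)) ^ 2)
      ≤ Real.sqrt ε * (1 + τ) ^ (-(5 : ℝ) / 4) * Real.sqrt (∫ x in Iic a,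
          (deriv (fun τ => φ τ x) 0 ^ 2 + deriv (φ 0) x ^ 2 + V x * φ 0 x ^ 2)) := by
  set EV : ℝ := ∫ x in Iic a, (deriv (fun τ => φ τ x) 0 ^ 2 + deriv (φ 0) x ^ 2
    + V x * φ 0 x ^ 2) with hEV
  have hdens_nn : ∀ x, 0 ≤ deriv (fun τ => φ τ x) 0 ^ 2 + deriv (φ 0) x ^ 2 + V x * φ 0 x ^ 2 :=
    fun x => wave1D_energyDensity_nonneg hV0 0 x
  have hτ1 : 0 < 1 + τ := by linarith
  -- `∫ V φ² ≤ EV` on the slice (energy monotonicity for the homogeneous solution `φ`)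
  have hmono := wave1D_trapezoid_energy_mono hV hV0 hφ hφsol (a := b) (b := a) (s := 0) hτ hτab
  simp only [add_zero, sub_zero] at hmono
  have hbase : (∫ x in b..a, (deriv (fun τ => φ τ x) 0 ^ 2 + deriv (φ 0) x ^ 2
      + V x * φ 0 x ^ 2)) ≤ EV := by
    rw [intervalIntegral.integral_of_le (by linarith), hEV]
    exact setIntegral_mono_set hEi (ae_of_all _ hdens_nn) (ae_of_all _ Ioc_subset_Iic_self)
  have cφτ : Continuous fun x => φ τ x := hφ.continuous.comp (continuous_const.prodMk continuous_id)
  have hVφ : (∫ x in (b + τ)..(a - τ), V x * φ τ x ^ 2)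
      ≤ ∫ x in (b + τ)..(a - τ), (deriv (fun σ' => φ σ' x) τ ^ 2 + deriv (φ τ) x ^ 2
        + V x * φ τ x ^ 2) := by
    refine intervalIntegral.integral_mono_on hτab ((hV.mul (cφτ.pow 2)).intervalIntegrable _ _)
      (((continuous_wave1D_energyDensity hV hφ).comp
        (continuous_const.prodMk continuous_id)).intervalIntegrable _ _) fun x _ => ?_
    nlinarith [sq_nonneg (deriv (fun σ' => φ σ' x) τ), sq_nonneg (deriv (φ τ) x)]
  have hK : 0 ≤ ε * (1 + τ) ^ (-(5 : ℝ) / 2) := mul_nonneg hε (Real.rpow_nonneg hτ1.le _)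
  have hsrc : (∫ x in (b + τ)..(a - τ), (-(V x * φ τ x)) ^ 2)
      ≤ ε * (1 + τ) ^ (-(5 : ℝ) / 2) * ∫ x in (b + τ)..(a - τ), V x * φ τ x ^ 2 := by
    rw [← intervalIntegral.integral_const_mul]
    refine intervalIntegral.integral_mono_on hτab (((hV.mul cφτ).neg.pow 2).intervalIntegrable _ _)
      (((hV.mul (cφτ.pow 2)).const_mul _).intervalIntegrable _ _) fun x hx => ?_
    have hVx : V x ≤ ε * (1 + τ) ^ (-(5 : ℝ) / 2) := hVε τ hτ x hx.2
    have hV0x := hV0 x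
    nlinarith [mul_le_mul_of_nonneg_right hVx (mul_nonneg hV0x (sq_nonneg (φ τ x)))]
  calc Real.sqrt (∫ x in (b + τ)..(a - τ), (-(V x * φ τ x)) ^ 2)
      ≤ Real.sqrt (ε * (1 + τ) ^ (-(5 : ℝ) / 2) * EV) := by
        refine Real.sqrt_le_sqrt (hsrc.trans ?_)
        exact mul_le_mul_of_nonneg_left (hVφ.trans (hmono.trans hbase)) hK
    _ = Real.sqrt ε * (1 + τ) ^ (-(5 : ℝ) / 4) * Real.sqrt EV := by
        rw [Real.sqrt_mul hK, Real.sqrt_mul hε, Real.sqrt_eq_rpow ((1 + τ) ^ (-(5 : ℝ) / 2)),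
          ← Real.rpow_mul hτ1.le]
        norm_num

/-- **Integrated source smallness, polynomial scale**: for `0 ≤ t`, `b + t ≤ a − t`,
`∫_0^t √(∫_{b+τ}^{a−τ} (Vφ)²) dτ ≤ 4√ε √EV`. [folklore] -/
theorem wave1D_integral_sqrt_source_sq_le_rpow (hV : Continuous V) (hV0 : ∀ x, 0 ≤ V x) {a ε : ℝ}
    (hε : 0 ≤ ε) (hVε : ∀ τ : ℝ, 0 ≤ τ → ∀ x, x ≤ a - τ → V x ≤ ε * (1 + τ) ^ (-(5 : ℝ) / 2))
    (hφ : ContDiff ℝ 2 (Function.uncurry φ))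
    (hφsol : ∀ t x, iteratedDeriv 2 (fun τ => φ τ x) t - iteratedDeriv 2 (φ t) x + V x * φ t x = 0)
    (hEi : IntegrableOn (fun x => deriv (fun τ => φ τ x) 0 ^ 2 + deriv (φ 0) x ^ 2
      + V x * φ 0 x ^ 2) (Iic a))
    {t b : ℝ} (ht : 0 ≤ t) (htab : b + t ≤ a - t) :
    (∫ τ in (0 : ℝ)..t, Real.sqrt (∫ x in (b + τ)..(a - τ), (-(V x * φ τ x)) ^ 2))
      ≤ 4 * Real.sqrt ε * Real.sqrt (∫ x in Iic a,
          (deriv (fun τ => φ τ x) 0 ^ 2 + deriv (φ 0) x ^ 2 + V x * φ 0 x ^ 2)) := by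
  set EV : ℝ := ∫ x in Iic a, (deriv (fun τ => φ τ x) 0 ^ 2 + deriv (φ 0) x ^ 2
    + V x * φ 0 x ^ 2) with hEV
  have hFw_cont : Continuous (Function.uncurry fun τ x => -(V x * φ τ x)) := by
    show Continuous fun p : ℝ × ℝ => -(V p.2 * φ p.1 p.2)
    exact ((hV.comp continuous_snd).mul hφ.continuous).neg
  have hk_cont : Continuous fun τ => Real.sqrt (∫ x in (b + τ)..(a - τ), (-(V x * φ τ x)) ^ 2) := by
    refine Real.continuous_sqrt.comp ?_
    have hF2 : Continuous (Function.uncurry fun τ x => (-(V x * φ τ x)) ^ 2) := by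
      show Continuous fun p : ℝ × ℝ => (-(V p.2 * φ p.1 p.2)) ^ 2
      exact (show Continuous fun p : ℝ × ℝ => -(V p.2 * φ p.1 p.2) from hFw_cont).pow 2
    have hP := intervalIntegral.continuous_parametric_primitive_of_continuous (μ := volume)
      (a₀ := (0 : ℝ)) hF2
    have c1 : Continuous fun τ : ℝ => ∫ x in (0 : ℝ)..(a - τ), (-(V x * φ τ x)) ^ 2 :=
      hP.comp (continuous_id.prodMk (continuous_const.sub continuous_id))
    have c2 : Continuous fun τ : ℝ => ∫ x in (0 : ℝ)..(b + τ), (-(V x * φ τ x)) ^ 2 :=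
      hP.comp (continuous_id.prodMk (continuous_const.add continuous_id))
    have heq : (fun τ => ∫ x in (b + τ)..(a - τ), (-(V x * φ τ x)) ^ 2)
        = fun τ => (∫ x in (0 : ℝ)..(a - τ), (-(V x * φ τ x)) ^ 2)
          - ∫ x in (0 : ℝ)..(b + τ), (-(V x * φ τ x)) ^ 2 := by
      funext τ
      have cF : Continuous fun x => (-(V x * φ τ x)) ^ 2 :=
        (hFw_cont.comp (continuous_const.prodMk continuous_id)).pow 2
      exact (integral_interval_sub_left (cF.intervalIntegrable _ _) (cF.intervalIntegrable _ _)).symm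
    rw [heq]; exact c1.sub c2
  have hk : ∀ τ ∈ Icc 0 t, Real.sqrt (∫ x in (b + τ)..(a - τ), (-(V x * φ τ x)) ^ 2)
      ≤ Real.sqrt ε * (1 + τ) ^ (-(5 : ℝ) / 4) * Real.sqrt EV := fun τ hτ =>
    wave1D_sqrt_source_sq_le_rpow hV hV0 hε hVε hφ hφsol hEi hτ.1 (by linarith [hτ.2])
  have hEV0 : 0 ≤ EV := setIntegral_nonneg measurableSet_Iic fun x _ =>
    wave1D_energyDensity_nonneg hV0 0 x
  rw [intervalIntegral.integral_of_le ht]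
  have hg : IntegrableOn (fun τ => Real.sqrt ε * Real.sqrt EV * (1 + τ) ^ (-(5 : ℝ) / 4))
      (Ioc 0 t) := by
    refine (ContinuousOn.integrableOn_Icc ?_).mono_set Ioc_subset_Icc_self
    exact continuousOn_const.mul (ContinuousOn.rpow_const (continuousOn_const.add continuousOn_id)
      fun x hx => Or.inl (by have : (0 : ℝ) ≤ x := hx.1; linarith))
  calc ∫ τ in Ioc 0 t, Real.sqrt (∫ x in (b + τ)..(a - τ), (-(V x * φ τ x)) ^ 2)
      ≤ ∫ τ in Ioc 0 t, Real.sqrt ε * Real.sqrt EV * (1 + τ) ^ (-(5 : ℝ) / 4) :=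
        integral_mono_of_nonneg (ae_of_all _ fun τ => Real.sqrt_nonneg _) hg
          ((ae_restrict_iff' measurableSet_Ioc).2 (ae_of_all _ fun τ hτ =>
            (hk τ (Ioc_subset_Icc_self hτ)).trans_eq (by ring)))
    _ = Real.sqrt ε * Real.sqrt EV * ∫ τ in (0 : ℝ)..t, (1 + τ) ^ (-(5 : ℝ) / 4) := by
        rw [MeasureTheory.integral_const_mul, intervalIntegral.integral_of_le ht]
    _ ≤ Real.sqrt ε * Real.sqrt EV * 4 :=
        mul_le_mul_of_nonneg_left (integral_one_add_rpow_le t ht) (by positivity)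
    _ = 4 * Real.sqrt ε * Real.sqrt EV := by ring

end Literature.Analysis.PDE
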